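import Mathlib
import Summits.Ventures.PercRepro2.TypedTwoTerminalConn

/-!
# The root-bundle transfer (blind cell PercRepro2, p2 g3, 2026-08-25) — graph and kernel level

A ROOT BUNDLE: a typed subgraph attached to the rest of the graph at exactly three terminals — the
two roots `a₁, a₂` and one more vertex `v` — through a set `I` of unmarked internal vertices (the
hat of `TypedHat.lean` is the case `I = {u}`). In a copy the outside sees only which of `v ↔ a₁`,
`v ↔ a₂`, `a₁ ↔ a₂` hold through the bundle; a copy joining the roots is killed by the crux kernel
(`KB_eq_zero_of_q'`), and otherwise the bundle acts as the two virtual edges `v–a₁`, `v–a₂`, open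
exactly when the bundle joins them (`conn_rootBundle`: the same closure-lemma induction as
`conn_twoTerminal`, with three terminals). Hence the kernel value at a placement of the bundle is
the kernel value at the two virtual edges (`K3_rootBundle`), which is what the counting identity
of `TypedRootBundle.lean` needs.
-/

namespace Summit.Ventures.PercRepro2

namespace CovForm

namespace TypedRed

namespace RootBundle

open TwoTerm OneTyped

section Conn

variable {V : Type*} {E : Type*} [DecidableEq E]

/-- **The root-bundle transfer.** `L` = the edges of the bundle, both ends in `I ∪ {v, a₁, a₂}`;
every edge at a vertex of `I` off `L` closed in `ω`; the bundle does not join the roots in `ω`;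
`j₁` / `j₂` say whether it joins `v` to `a₁` / `a₂`. Then, for `p, q ∉ I`: `p ↔ q` in `ω` iff
`p ↔ q` in `ω` with `L` closed and `h₁ ∈ L`, `h₂ ∈ L` re-attached to `s(v, a₁)`, `s(v, a₂)` and
open iff `j₁`, `j₂`. -/
theorem conn_rootBundle {ends : E → Sym2 V} {I : Set V} {v a₁ a₂ : V} (hv : v ∉ I) (h1 : a₁ ∉ I)
    (h2 : a₂ ∉ I) {L : Finset E} (hLI : ∀ e ∈ L, ∀ x ∈ ends e, x ∈ I ∨ x = v ∨ x = a₁ ∨ x = a₂)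
    {h₁ h₂ : E} (h₁L : h₁ ∈ L) (h₂L : h₂ ∈ L) (h12 : h₁ ≠ h₂) (ω : Config E)
    (hcl : ∀ e, e ∉ L → (∃ x ∈ I, x ∈ ends e) → ω e = false)
    (hroots : ¬ Conn ends (onL L ω) a₁ a₂)
    {j₁ j₂ : Bool} (hj₁ : j₁ = true ↔ Conn ends (onL L ω) v a₁)
    (hj₂ : j₂ = true ↔ Conn ends (onL L ω) v a₂) {p q : V} (hp : p ∉ I) (hq : q ∉ I) :
    Conn ends ω p q ↔
      Conn (Function.update (Function.update ends h₁ s(v, a₁)) h₂ s(v, a₂))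
        (Function.update (Function.update (offL L ω) h₁ j₁) h₂ j₂) p q := by
  set ends' := Function.update (Function.update ends h₁ s(v, a₁)) h₂ s(v, a₂) with hends'
  set ω' := Function.update (Function.update (offL L ω) h₁ j₁) h₂ j₂ with hω'
  have hends1 : ends' h₁ = s(v, a₁) := by
    rw [hends', Function.update_of_ne h12, Function.update_self]
  have hends2 : ends' h₂ = s(v, a₂) := by rw [hends', Function.update_self]
  have hω1 : ω' h₁ = j₁ := by rw [hω', Function.update_of_ne h12, Function.update_self]
  have hω2 : ω' h₂ = j₂ := by rw [hω', Function.update_self]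
  have hoff : ∀ e, e ≠ h₁ → e ≠ h₂ → ends' e = ends e ∧ ω' e = offL L ω e := fun e he1 he2 => by
    rw [hends', hω', Function.update_of_ne he2, Function.update_of_ne he1,
      Function.update_of_ne he2, Function.update_of_ne he1]
    exact ⟨rfl, rfl⟩
  -- the virtual edges
  have hvirt1 : Conn ends (onL L ω) v a₁ → Conn ends' ω' v a₁ := fun hc =>
    conn_of_openAdj ⟨h₁, by rw [hω1]; exact hj₁.2 hc, hends1⟩
  have hvirt2 : Conn ends (onL L ω) v a₂ → Conn ends' ω' v a₂ := fun hc =>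
    conn_of_openAdj ⟨h₂, by rw [hω2]; exact hj₂.2 hc, hends2⟩
  -- a vertex of an edge of `L` off `I` is a terminal
  have hterm : ∀ e ∈ L, ∀ x ∈ ends e, x ∉ I → x = v ∨ x = a₁ ∨ x = a₂ := fun e he x hx hxI => by
    rcases hLI e he x hx with h | h | h | h
    · exact absurd h hxI
    · exact Or.inl h
    · exact Or.inr (Or.inl h)
    · exact Or.inr (Or.inr h)
  -- two distinct terminals joined in the `L`-part are joined by a virtual edge
  have hpair : ∀ x y : V, (x = v ∨ x = a₁ ∨ x = a₂) → (y = v ∨ y = a₁ ∨ y = a₂) → x ≠ y →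
      Conn ends (onL L ω) x y → Conn ends' ω' x y := fun x y hx hy hxy hc => by
    rcases hx with rfl | rfl | rfl <;> rcases hy with rfl | rfl | rfl
    · exact absurd rfl hxy
    · exact hvirt1 hc
    · exact hvirt2 hc
    · exact conn_symm (hvirt1 (conn_symm hc))
    · exact absurd rfl hxy
    · exact absurd hc hroots
    · exact conn_symm (hvirt2 (conn_symm hc))
    · exact absurd (conn_symm hc) hroots
    · exact absurd rfl hxy
  constructor
  · intro hpq
    let S : Set V := {x | (x ∉ I ∧ Conn ends' ω' p x) ∨
      (x ∈ I ∧ ∃ r, (r = v ∨ r = a₁ ∨ r = a₂) ∧ Conn ends' ω' p r ∧ Conn ends (onL L ω) r x)}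
    have hpS : p ∈ S := Or.inl ⟨hp, conn_refl _ _ _⟩
    have hclosed : ∀ x ∈ S, ∀ y, (openGraph ends ω).Adj x y → y ∈ S := by
      intro x hx y hxy
      rw [openGraph_adj] at hxy
      obtain ⟨hne, e, he, hends⟩ := hxy
      have hxe : x ∈ ends e := by rw [hends]; exact Sym2.mem_mk_left x y
      have hye : y ∈ ends e := by rw [hends]; exact Sym2.mem_mk_right x y
      by_cases heL : e ∈ L
      · have hconnL : Conn ends (onL L ω) x y :=
          conn_of_openAdj ⟨e, by rw [onL_of_mem heL]; exact he, hends⟩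
        rcases hx with ⟨hxI, hpx⟩ | ⟨hxI, r, hr, hpr, hrx⟩
        · have hxt := hterm e heL x hxe hxI
          by_cases hyI : y ∈ I
          · exact Or.inr ⟨hyI, x, hxt, hpx, hconnL⟩
          · have hyt := hterm e heL y hye hyI
            exact Or.inl ⟨hyI, conn_trans hpx (hpair x y hxt hyt hne hconnL)⟩
        · have hry : Conn ends (onL L ω) r y := conn_trans hrx hconnL
          by_cases hyI : y ∈ I
          · exact Or.inr ⟨hyI, r, hr, hpr, hry⟩
          · have hyt := hterm e heL y hye hyI
            by_cases hry' : r = y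
            · subst hry'; exact Or.inl ⟨hyI, hpr⟩
            · exact Or.inl ⟨hyI, conn_trans hpr (hpair r y hr hyt hry' hry)⟩
      · have hxI : x ∉ I := fun hxI => by
          have := hcl e heL ⟨x, hxI, hxe⟩; rw [he] at this; exact Bool.noConfusion this
        have hyI : y ∉ I := fun hyI => by
          have := hcl e heL ⟨y, hyI, hye⟩; rw [he] at this; exact Bool.noConfusion this
        have he1 : e ≠ h₁ := fun h => heL (h ▸ h₁L)
        have he2 : e ≠ h₂ := fun h => heL (h ▸ h₂L)
        obtain ⟨hendse, hωe⟩ := hoff e he1 he2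
        have hadj : OpenAdj ends' ω' x y :=
          ⟨e, by rw [hωe, offL_of_not_mem heL]; exact he, by rw [hendse]; exact hends⟩
        rcases hx with ⟨_, hpx⟩ | ⟨hxI', _⟩
        · exact Or.inl ⟨hyI, conn_trans hpx (conn_of_openAdj hadj)⟩
        · exact absurd hxI' hxI
    have hqS : q ∈ S := mem_of_conn_of_closed hclosed hpS hpq
    rcases hqS with ⟨_, h⟩ | ⟨hqI, _⟩
    · exact h
    · exact absurd hqI hq
  · intro hpq
    let S : Set V := {x | Conn ends ω p x}
    have hpS : p ∈ S := conn_refl _ _ _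
    have hclosed : ∀ x ∈ S, ∀ y, (openGraph ends' ω').Adj x y → y ∈ S := by
      intro x hx y hxy
      rw [openGraph_adj] at hxy
      obtain ⟨hne, e, he, hends⟩ := hxy
      by_cases he1 : e = h₁
      · subst he1
        rw [hω1] at he
        rw [hends1] at hends
        have hva : Conn ends ω v a₁ := conn_mono (onL_le L ω) (hj₁.1 he)
        have hxy : Conn ends ω x y := by
          rcases Sym2.eq_iff.1 hends with ⟨rfl, rfl⟩ | ⟨rfl, rfl⟩
          · exact hva
          · exact conn_symm hva
        exact conn_trans hx hxy
      by_cases he2 : e = h₂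
      · subst he2
        rw [hω2] at he
        rw [hends2] at hends
        have hva : Conn ends ω v a₂ := conn_mono (onL_le L ω) (hj₂.1 he)
        have hxy : Conn ends ω x y := by
          rcases Sym2.eq_iff.1 hends with ⟨rfl, rfl⟩ | ⟨rfl, rfl⟩
          · exact hva
          · exact conn_symm hva
        exact conn_trans hx hxy
      obtain ⟨hendse, hωe⟩ := hoff e he1 he2
      rw [hωe] at he
      rw [hendse] at hends
      have heL : e ∉ L := fun heL => by
        rw [offL_of_mem heL] at he; exact Bool.noConfusion he
      rw [offL_of_not_mem heL] at he
      exact conn_trans hx (conn_of_openAdj ⟨e, he, hends⟩)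
    exact mem_of_conn_of_closed hclosed hpS hpq

end Conn

/-! ## The kernel -/

section Kernel

open Classical

variable {V : Type*} {E : Type*} [Fintype E] [DecidableEq E] {R : Type*} [Field R]

/-- The joining flags of a configuration supported on the bundle: `v ↔ a₁` (or the roots joined),
`v ↔ a₂` (or the roots joined). -/
noncomputable def flag₁ (ends : E → Sym2 V) (v a₁ a₂ : V) (a : Config E) : Bool :=
  decide (Conn ends a v a₁ ∨ Conn ends a a₁ a₂)

/-- The second joining flag. -/
noncomputable def flag₂ (ends : E → Sym2 V) (v a₁ a₂ : V) (a : Config E) : Bool :=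
  decide (Conn ends a v a₂ ∨ Conn ends a a₁ a₂)

omit [Fintype E] [DecidableEq E] in
/-- If the roots are joined in a copy, the crux kernel vanishes. -/
lemma K3_eq_zero_of_conn_roots (ends : E → Sym2 V) (o a₁ a₂ a₃ b : V) {x y w : Config E}
    (h : Conn ends x a₁ a₂ ∨ Conn ends y a₁ a₂ ∨ Conn ends w a₁ a₂) :
    (K3 ends o a₁ a₂ a₃ b x y w : R) = 0 := by
  rw [K3_eq_KB]
  have key : ∀ u : Config E, Conn ends u a₁ a₂ → (st ends o a₁ a₂ a₃ b u).q' = true := fun u hu => by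
    unfold st St.q'
    exact decide_eq_true (conn_symm hu)
  rw [KB_eq_zero_of_q' _ _ _ (by
    rcases h with h | h | h
    · exact Or.inl (key _ h)
    · exact Or.inr (Or.inl (key _ h))
    · exact Or.inr (Or.inr (key _ h)))]
  simp

omit [Fintype E] in
/-- With both virtual edges open in a copy, the roots are joined there. -/
lemma conn_roots_of_flags (ends : E → Sym2 V) {v a₁ a₂ : V} {h₁ h₂ : E} (h12 : h₁ ≠ h₂)
    (x : Config E) :
    Conn (Function.update (Function.update ends h₁ s(v, a₁)) h₂ s(v, a₂))
      (Function.update (Function.update x h₁ true) h₂ true) a₁ a₂ := by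
  have e1 : OpenAdj (Function.update (Function.update ends h₁ s(v, a₁)) h₂ s(v, a₂))
      (Function.update (Function.update x h₁ true) h₂ true) v a₁ :=
    ⟨h₁, by rw [Function.update_of_ne h12, Function.update_self],
      by rw [Function.update_of_ne h12, Function.update_self]⟩
  have e2 : OpenAdj (Function.update (Function.update ends h₁ s(v, a₁)) h₂ s(v, a₂))
      (Function.update (Function.update x h₁ true) h₂ true) v a₂ :=
    ⟨h₂, by rw [Function.update_self], by rw [Function.update_self]⟩
  exact conn_trans (conn_symm (conn_of_openAdj e1)) (conn_of_openAdj e2)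

omit [Fintype E] in
/-- **The kernel at a placement of the bundle is the kernel at the two virtual edges.** -/
theorem K3_rootBundle (ends : E → Sym2 V) (o a₁ a₂ a₃ b : V) {I : Set V} {v : V} (hv : v ∉ I)
    (hI : ∀ x ∈ I, x ≠ o ∧ x ≠ a₁ ∧ x ≠ a₂ ∧ x ≠ a₃ ∧ x ≠ b) {L : Finset E}
    (hLI : ∀ e ∈ L, ∀ x ∈ ends e, x ∈ I ∨ x = v ∨ x = a₁ ∨ x = a₂) {h₁ h₂ : E} (h₁L : h₁ ∈ L)
    (h₂L : h₂ ∈ L) (h12 : h₁ ≠ h₂) {a b' c x y w : Config E}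
    (ha : ∀ e, e ∉ L → a e = false) (hb : ∀ e, e ∉ L → b' e = false)
    (hc : ∀ e, e ∉ L → c e = false)
    (hx : ∀ e ∈ L, x e = false) (hy : ∀ e ∈ L, y e = false) (hw : ∀ e ∈ L, w e = false)
    (hclx : ∀ e, e ∉ L → (∃ u ∈ I, u ∈ ends e) → x e = false)
    (hcly : ∀ e, e ∉ L → (∃ u ∈ I, u ∈ ends e) → y e = false)
    (hclw : ∀ e, e ∉ L → (∃ u ∈ I, u ∈ ends e) → w e = false) :
    (K3 ends o a₁ a₂ a₃ b (patchL L a x) (patchL L b' y) (patchL L c w) : R) =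
      K3 (Function.update (Function.update ends h₁ s(v, a₁)) h₂ s(v, a₂)) o a₁ a₂ a₃ b
        (Function.update (Function.update x h₁ (flag₁ ends v a₁ a₂ a)) h₂ (flag₂ ends v a₁ a₂ a))
        (Function.update (Function.update y h₁ (flag₁ ends v a₁ a₂ b')) h₂ (flag₂ ends v a₁ a₂ b'))
        (Function.update (Function.update w h₁ (flag₁ ends v a₁ a₂ c)) h₂ (flag₂ ends v a₁ a₂ c)) := by
  have h1 : a₁ ∉ I := fun h => (hI a₁ h).2.1 rfl
  have h2 : a₂ ∉ I := fun h => (hI a₂ h).2.2.1 rfl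
  -- a copy whose bundle joins the roots kills both sides
  have hkill : ∀ (a' x' : Config E), (∀ e, e ∉ L → a' e = false) → Conn ends a' a₁ a₂ →
      Conn ends (patchL L a' x') a₁ a₂ ∧
        Conn (Function.update (Function.update ends h₁ s(v, a₁)) h₂ s(v, a₂))
          (Function.update (Function.update x' h₁ (flag₁ ends v a₁ a₂ a'))
            h₂ (flag₂ ends v a₁ a₂ a')) a₁ a₂ := by
    intro a' x' ha' hr
    refine ⟨conn_mono (fun e => ?_) hr, ?_⟩
    · by_cases he : e ∈ L
      · rw [patchL_of_mem he]
      · rw [ha' e he]; exact Bool.false_le _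
    · have f1 : flag₁ ends v a₁ a₂ a' = true := decide_eq_true (Or.inr hr)
      have f2 : flag₂ ends v a₁ a₂ a' = true := decide_eq_true (Or.inr hr)
      rw [f1, f2]
      exact conn_roots_of_flags ends h12 x'
  by_cases hr : Conn ends a a₁ a₂ ∨ Conn ends b' a₁ a₂ ∨ Conn ends c a₁ a₂
  · rw [K3_eq_zero_of_conn_roots ends o a₁ a₂ a₃ b (by
        rcases hr with hr | hr | hr
        · exact Or.inl (hkill a x ha hr).1
        · exact Or.inr (Or.inl (hkill b' y hb hr).1)
        · exact Or.inr (Or.inr (hkill c w hc hr).1)),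
      K3_eq_zero_of_conn_roots _ o a₁ a₂ a₃ b (by
        rcases hr with hr | hr | hr
        · exact Or.inl (hkill a x ha hr).2
        · exact Or.inr (Or.inl (hkill b' y hb hr).2)
        · exact Or.inr (Or.inr (hkill c w hc hr).2))]
  · rw [not_or, not_or] at hr
    obtain ⟨hra, hrb, hrc⟩ := hr
    -- the states agree copy by copy
    have hst : ∀ (a' x' : Config E), (∀ e, e ∉ L → a' e = false) → (∀ e ∈ L, x' e = false) →
        (∀ e, e ∉ L → (∃ u ∈ I, u ∈ ends e) → x' e = false) → ¬ Conn ends a' a₁ a₂ →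
        st ends o a₁ a₂ a₃ b (patchL L a' x') =
          st (Function.update (Function.update ends h₁ s(v, a₁)) h₂ s(v, a₂)) o a₁ a₂ a₃ b
            (Function.update (Function.update x' h₁ (flag₁ ends v a₁ a₂ a'))
              h₂ (flag₂ ends v a₁ a₂ a')) := by
      intro a' x' ha' hx' hcl' hr'
      have honL : onL L (patchL L a' x') = a' := onL_patchL ha' x'
      have hcl'' : ∀ e, e ∉ L → (∃ u ∈ I, u ∈ ends e) → patchL L a' x' e = false :=
        fun e he hu => by rw [patchL_of_not_mem he]; exact hcl' e he hu
      have hroots : ¬ Conn ends (onL L (patchL L a' x')) a₁ a₂ := by rw [honL]; exact hr'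
      have hj₁ : flag₁ ends v a₁ a₂ a' = true ↔ Conn ends (onL L (patchL L a' x')) v a₁ := by
        rw [honL, flag₁, decide_eq_true_iff]
        exact ⟨fun h => h.resolve_right hr', Or.inl⟩
      have hj₂ : flag₂ ends v a₁ a₂ a' = true ↔ Conn ends (onL L (patchL L a' x')) v a₂ := by
        rw [honL, flag₂, decide_eq_true_iff]
        exact ⟨fun h => h.resolve_right hr', Or.inl⟩
      have key := fun {p q : V} (hp : p ∉ I) (hq : q ∉ I) =>
        conn_rootBundle hv h1 h2 hLI h₁L h₂L h12 (patchL L a' x') hcl'' hroots hj₁ hj₂ hp hq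
      have := offL_patchL a' hx'
      rw [this] at key
      have ho : o ∉ I := fun h => (hI o h).1 rfl
      have h3 : a₃ ∉ I := fun h => (hI a₃ h).2.2.2.1 rfl
      have hb' : b ∉ I := fun h => (hI b h).2.2.2.2 rfl
      unfold st
      simp only [Prod.mk.injEq]
      exact ⟨decide_eq_decide.mpr (key h2 h1), decide_eq_decide.mpr (key h1 ho),
        decide_eq_decide.mpr (key h2 ho), decide_eq_decide.mpr (key h1 hb'),
        decide_eq_decide.mpr (key h2 hb'), decide_eq_decide.mpr (key h1 h3),
        decide_eq_decide.mpr (key h2 h3)⟩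
    rw [K3_eq_KB, K3_eq_KB, hst a x ha hx hclx hra, hst b' y hb hy hcly hrb, hst c w hc hw hclw hrc]

end Kernel

end RootBundle

end TypedRed

end CovForm

end Summit.Ventures.PercRepro2
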